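import Summits.BirchSwinnertonDyer.BirchSwinnertonDyer.Theorems.SchneiderFreeAdditiveX3KYBranchThreeAnomalous
import Summits.BirchSwinnertonDyer.BirchSwinnertonDyer.Theorems.SchneiderFreeAdditiveX3GordCellThreeAux
import Summits.BirchSwinnertonDyer.BirchSwinnertonDyer.Theorems.SchneiderFreeAdditiveX3GordCellThreeOfPrint
import Literature.NumberTheory.GaloisCohomology.RestrictedRamificationCdTwoBaseChange
import HarnessLib

/-!
# Route `SchneiderFreeAdditiveX3` (K1 door): the (G-ord, `e = 2`) LOWER socket AT `p = 3` FOR AN ANOMALOUS TWIST, per Heegner datum, for a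
# Keller–Yin-normalised curve — from Kolyvagin ∧ Hsieh ∧ LZZ ∧ Castella–Hsieh (signed) ∧ [DIV.dvd] ∧ the typed analytic count
# `thm351_anacong_branch_three_allTwists` ∧ [RH] ∧ [PWL-θ] ∧ SIXTEEN published facts — NO existence hypothesis, NO [BR] input

Cell `bsd-schneider-ideate`, seat `bsd-schneider-door-c5` (prover, generation 32; assembly layer; `--supports` 19177, helper).
PARTITION: board row B6 ∩ X3 ∩ sst-twist, `r = 1`, (G-ord, `e = 2`) half at `p = 3` — the 1 725 ANOMALOUS pairs (census kit j319291) of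
`Rank1Residual.partition` — the anomalous twin of generation 26/27's per-datum NAT door (`KYBranchThreeDoor`, `KYBranchThreeAux`); types-the-object-of
nothing; closes none of B6's cells (BSD NOT advanced).  bears_on: K1-door (19177 r3 `GordTwoBranchIMC`).  FILE 14 of the anomalous-twin port.

WHAT.
* §1 `xac_charIdeal_map_le_span_three_self_anomalous_of_dvd` — H3♭ᶜ at every ♭-frame of the conjugate prime, `p = 3`, for the presented
  curve `W = C₂ • ((D • W′) ⊗ χ_{−3})` ITSELF (Case (I), `W′` good at `3` with parametrisation datum `Dt′`, `3 ∤ N′`) on the (G-ord, `e = 2`) cell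
  with `r_an = 1`, an ANOMALOUS good-ordinary twist model `W = C • V^{(3*)}` and Keller–Yin's ∀-normalisation: generation 26's
  `KYBranchThreeDoor.xac_charIdeal_map_le_span_three_self_of_dvd` with its NAT inputs ([AN3], [BR3], CGLS Props. 1.2.5/14/Cor. 1.2.6, `hna`, `hlat`,
  `htf`, the displayed comparison data) REPLACED by FILE 13 (`KYBranchThreeAnomalous.xac_charIdeal_map_eq_span_three_anomalous_of_dvd`) fed by the
  hna-free typed count `thm351_anacong_branch_three_allTwists` at `θ₀ := θquot|_K` (the `3`-unramified member, FILE 13 §0), its Hecke character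
  (class field theory, `exists_heckeCharacter_of_pow_eq_one`) and Katz frame (CGLS Thm. 2.1.2 `thm212_exists_isKatzLFunction`), [RH] + [PWL-θ], the
  four published [BR] facts, Greenberg ×5, NSW (8.3.18) — now the tree THEOREM `groupCdLE_two_galoisGroupUnramifiedOutside_holds` —; `hlat` and
  `W(K)[3] = 0` DERIVED from the normalisation (generation 31 F8b); then the rigidity `(L) ⊆ (Q)` verbatim.
* §2 `additiveIMCLowerBDPOnTree_subGordTwo_three_offSliver_anomalous_self` — the per-datum (G-ord, `e = 2`) LOWER socket AT `p = 3`, off the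
  `d_K = −3` sliver, for EVERY globally minimal curve of the cell with `r_an = 1`, an anomalous twist model and the ∀-normalisation:
  `AdditiveIMCLowerBDPOnTreeLeAt 3 κ 𝔭 γ ι_𝔭 (v_3 c) P` at every Heegner datum with `d_K ≠ −3` and every anticyclotomic frame — generation 26's
  `additiveIMCLowerBDPOnTree_subGordTwo_three_offSliver_self` pattern (Kolyvagin, Hsieh 2014 Thm. A, Liu–Zhang–Zhang 2018, the CLOSED control corner
  by name inside `additiveIMCLowerBDPOnTreeLeAt_of_kolyvagin_of_hsieh_of_lzz_of_intDivConj`) over §1.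

INPUT LEDGER PER DATUM, (G-ord, `e = 2`), `p = 3`, ANOMALOUS: PUBLISHED facts by name (Kolyvagin, modularity, Hsieh A, LZZ, Castella–Hsieh signed,
CGLS Thm. 2.1.2, Greenberg 2016 ×2, Greenberg 2006 ×4, Bleher et al. 3.3.1, de Shalit II.6.4, Hida Thm. I) ∪ {[DIV.dvd] (PREPRINT), the analytic
count `thm351_anacong_branch_three_allTwists` (PREPRINT sentence, PUB-composed at `p = 3` per FINDING-door-c5-g26 §2 read without NAT, audit
pending), [RH], [PWL-θ] (bsd-eis typed)} — the SAME SHAPE as the NAT door's ledger (generation 27) with CGLS Prop. 14 / Thm. 1.2.2 replaced by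
[RH]/[PWL-θ] and the four published [BR] facts.  Per-curve hypotheses: the anomalous model and the ∀-normalisation (no `htf`, no `hlat`, no AUX).

HONEST FRAMING: THEOREMS ONLY; pure composition of tree theorems, CONDITIONAL on the displayed hypotheses; [DIV.dvd] and the count are
unrefereed-preprint sentences (the count PUB-composed at `p = 3`, audit pending); nothing is closed by me; BSD is proved for no curve; «closes
rung: none».  References: [KellerYin2024b] Thm. 3.3.6, Prop. 3.4.4, Thm. 3.5.1; [KellerYin2024] Thms. 1.2.2, 1.4.1, 2.2.2, 2.2.3, Prop. 1.2.5;
[CastellaGrossiLeeSkinner2022] Thms. 2.1.2, 2.2.2; [CastellaHsieh2018] §3.3; [Hsieh2014] Thm. A; [LiuZhangZhang2018] Thm 1.5.1/1.5.3;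
[BleherEtAl2020] 3.3.1; [deShalit1987] II.6.4; [Hida2010MuInvariant] Thm. I; [NeukirchSchmidtWingberg2008] (8.3.18); this seat p725019 (F13),
p680959/p684153 (gens 26–27, templates).
-/

set_option autoImplicit false
-- `Summit.<P>.<Sub>` repeats `BirchSwinnertonDyer` by the tree's layout convention (D-0017)
set_option linter.dupNamespace false

noncomputable section

open scoped Classical NumberField

open Field NumberField IsDedekindDomain WeierstrassCurve PowerSeries
  Literature.NumberTheory.EllipticCurves Literature.NumberTheory.EllipticCurves.GreenbergSelmer
  Literature.NumberTheory.GaloisRepresentations Literature.NumberTheory.GaloisCohomology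
  Literature.NumberTheory.EllipticCurves.ModularForms Literature.NumberTheory.EllipticCurves.Rank1Residual
  Literature.NumberTheory.EllipticCurves.KellerYin2024 Literature.NumberTheory.EllipticCurves.CaiShuTian2014
  Literature.NumberTheory.IwasawaTheory Literature.NumberTheory.IwasawaTheory.Greenberg2016
  Literature.NumberTheory.IwasawaTheory.Greenberg2006
  Literature.NumberTheory.EllipticCurves.Rubin1991 Literature.NumberTheory.EllipticCurves.DeShalit1987
  Literature.NumberTheory.EllipticCurves.Hida2010MuInvariant Literature.NumberTheory.EllipticCurves.BCGKPST2020
  Summit.BirchSwinnertonDyer.Rank1Residual Summit.BirchSwinnertonDyer.Rank1Residual.X11b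
  Summit.BirchSwinnertonDyer.Rank1Residual.X11b.AcSelmer Summit.BirchSwinnertonDyer.Rank1Residual.X11b.Halves
  Summit.BirchSwinnertonDyer.Rank1Residual.X11b.CongruenceLimit
  Summit.BirchSwinnertonDyer.Rank1Residual.Additive Summit.BirchSwinnertonDyer.Rank1Residual.GaloisImage
  Summit.BirchSwinnertonDyer.BirchSwinnertonDyer.Theorems
  Summit.BirchSwinnertonDyer.BirchSwinnertonDyer.Theorems.EisensteinPrimesMuLambda
  Summit.BirchSwinnertonDyer.BirchSwinnertonDyer.Theorems.SchneiderFree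
  Summit.BirchSwinnertonDyer.BirchSwinnertonDyer.Theorems.SchneiderFree.KYRead
  Summit.BirchSwinnertonDyer.BirchSwinnertonDyer.Theses.SchneiderFreeAdditiveX3
  Summit.BirchSwinnertonDyer.BirchSwinnertonDyer.Theorems.SchneiderFreeAdditiveX3.LZZMatch
  Summit.BirchSwinnertonDyer.BirchSwinnertonDyer.Theorems.SchneiderFreeAdditiveX3.ControlDischarged
  Summit.BirchSwinnertonDyer.BirchSwinnertonDyer.Theorems.SchneiderFreeAdditiveX3.KYBranchOnly
  Summit.BirchSwinnertonDyer.BirchSwinnertonDyer.Theorems.SchneiderFreeAdditiveX3.KYBranchThree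
  Summit.BirchSwinnertonDyer.BirchSwinnertonDyer.Theorems.SchneiderFreeAdditiveX3.KYBranchThreeDoor
open Literature.NumberTheory.EllipticCurves.CastellaGrossiLeeSkinner2022 (IsKatzLFunction thm212_exists_isKatzLFunction)
open Literature.NumberTheory.EllipticCurves.KellerYin2024 (thm122_rubinHida_residualPair_unrSelmer prop125_residualPair_unrSelmer_imprimitive
  thm351_anacong_branch_three_allTwists)

namespace Summit.BirchSwinnertonDyer.BirchSwinnertonDyer.Theorems.SchneiderFreeAdditiveX3.KYBranchThreeAnomalousDoor

/-! ### §1 H3♭ᶜ at every ♭-frame of the conjugate prime, `p = 3`, ANOMALOUS twist, the curve itself Keller–Yin-normalised (∀-form) -/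

/-- **H3♭ᶜ at a ♭-frame of the conjugate prime at `p = 3` for an ANOMALOUS twist ⇐ [DIV.dvd] ∧ the typed hna-free analytic count ∧ [RH] ∧
[PWL-θ] ∧ Castella–Hsieh signed existence ∧ CGLS Thm. 2.1.2 ∧ fourteen further published facts** — generation 26's
`KYBranchThreeDoor.xac_charIdeal_map_le_span_three_self_of_dvd` for the presented curve `W = C₂ • ((D • W′) ⊗ χ_{−3})` ITSELF on the (G-ord,
`e = 2`) cell with `r_an(W) = 1`, an ANOMALOUS good-ordinary twist model `W = C • V^{(3*)}` (`GoodOrd V 3`, `3 ∣ a₃(V) − 1`) and Keller–Yin's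
normalisation «every rational `3`-line of `W` is `D₃`-non-trivial», with Keller–Yin's KYb/KYμ replaced by FILE 13
(`KYBranchThreeAnomalous.xac_charIdeal_map_eq_span_three_anomalous_of_dvd`): the residual pair is the restricted Teichmüller pair of a rational
`3`-line, the `3`-unramified member is `θquot` (FILE 13 §0), its Hecke character exists by class field theory and its Katz frame by CGLS Thm. 2.1.2
(`h212`), the count comes from `thm351_anacong_branch_three_allTwists` BY NAME, `cd₃ ≤ 2` is the tree theorem NSW (8.3.18), `hlat`/`W(K)[3] = 0`
follow from the normalisation.  Conclusion: for EVERY ♭-frame `Q` of `Dt.f` at `(ι′, 𝔭′)`, `Ch_Λ(X_ac^∅(W_K) at 𝔭)·𝓞_{ℂ_3}⟦T⟧ ⊆ (Q)`.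
CONDITIONAL on the named statements; nothing asserted about BSD. [claim: KellerYin2024PotOrd, status: under-review]
[cite: KellerYin2024b, Thm. 3.5.1 and Rem. 3.5.2 (arXiv:2410.23241 p. 20) (preprint; the Kolyvagin clause a hypothesis)]
[cite: KellerYin2024, Thms. 1.2.2, 1.4.1, 2.2.2, 2.2.3 (arXiv:2402.12781v2)] [cite: CastellaHsieh2018, §3.3, Def. 3.7 and Prop. 3.8 (the signed branch frame)]
[cite: CastellaGrossiLeeSkinner2022, Thms. 2.1.2, 2.2.2] [cite: NeukirchSchmidtWingberg2008, (8.3.18)] -/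
theorem xac_charIdeal_map_le_span_three_self_anomalous_of_dvd
    (hCHσ : castellaHsieh2018_exists_isBranchBDPLFunction_signed)
    (hDVD : thm336_dvd_branch_OPEN) (hAN : thm351_anacong_branch_three_allTwists) (h212 : thm212_exists_isKatzLFunction)
    (hRH : thm122_rubinHida_residualPair_unrSelmer) (hPWL : prop125_residualPair_unrSelmer_imprimitive)
    (h331 : thm331_rubin_exists_katzMeasure₂_pseudoIso_span_eq) (h411 : prop411_selmer_isAlmostDivisible)
    (hF : thmII64_katzMeasure₂_functionalEquation) (hO1 : thmI_mu_katzBranch_reflect_eq_zero)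
    (h263 : prop263_sur_of_crk) (h41 : prop41_globalEulerPoincareCorank)
    (h42 : prop42_localEulerPoincareCorank) (h5A : sec5A_localH2_subsingleton_of_LOC1)
    (h32 : prop32_cohomology_isCofinitelyGenerated)
    (hmodN : exists_isNewformOf)
    -- the good partner `W′`, the presentation of the door's curve at `p = 3`
    (W' : WeierstrassCurve ℚ) [W'.IsElliptic] (hgood : W'.HasGoodReductionAtPrime 3) (D C₂ : VariableChange ℚ)
    [(C₂ • (D • W').quadraticTwist ((-1 : ℚ) ^ (3 / 2) * (3 : ℕ))).IsElliptic]
    [(C₂ • (D • W').quadraticTwist ((-1 : ℚ) ^ (3 / 2) * (3 : ℕ))).IsGloballyMinimal] {N : ℕ} [NeZero N]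
    (Dt : ModularParametrizationData (C₂ • (D • W').quadraticTwist ((-1 : ℚ) ^ (3 / 2) * (3 : ℕ))) N)
    {N' : ℕ} [NeZero N'] (Dt' : ModularParametrizationData W' N') (hpN' : ¬ 3 ∣ N')
    -- the socket's field, tower, primes, embedding datum; Heegner for `N` and for the partner's level
    {K : Type} [Field K] [NumberField K] [IsGalois ℚ K] (hK : IsImaginaryQuadratic K)
    (hHe : SatisfiesHeegnerHypothesis N K) (hHe' : SatisfiesHeegnerHypothesis N' K)
    (hodd : Odd (NumberField.discr K)) (hdK : NumberField.discr K ≠ -3)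
    {κ : ZpExtension K 3} (hκ : κ.IsAnticyclotomic) (γ : absoluteGaloisGroup K) [hγ : Fact (κ.IsTopGenerator γ)]
    {𝔭 : HeightOneSpectrum (𝓞 K)} (h𝔭 : ((3 : ℕ) : 𝓞 K) ∈ 𝔭.asIdeal)
    (he : 𝔭.asIdeal.ramificationIdx (𝓞 ℚ) = 1) (hf : 𝔭.asIdeal.inertiaDeg (𝓞 ℚ) = 1)
    {𝔭' : HeightOneSpectrum (𝓞 K)} (h𝔭' : ((3 : ℕ) : 𝓞 K) ∈ 𝔭'.asIdeal) (hne : 𝔭 ≠ 𝔭')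
    {ι' : PadicAlgCl 3 ≃+* ℂ} (hι' : BranchInducesPrime 3 ι' 𝔭')
    -- the curve lies in the (G-ord) cell with `r_an = 1`, has an ANOMALOUS twist model and is Keller–Yin-normalised (∀-form)
    (hN : (C₂ • (D • W').quadraticTwist ((-1 : ℚ) ^ (3 / 2) * (3 : ℕ))).conductorNorm ℤ = N)
    (hcase : (C₂ • (D • W').quadraticTwist ((-1 : ℚ) ^ (3 / 2) * (3 : ℕ))).HasGoodOrdinaryReductionOverQuadraticAt 3)
    (hX : ClassX3 (C₂ • (D • W').quadraticTwist ((-1 : ℚ) ^ (3 / 2) * (3 : ℕ))) 3)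
    (hSG : SubGordTwo (C₂ • (D • W').quadraticTwist ((-1 : ℚ) ^ (3 / 2) * (3 : ℕ))) 3)
    (hr : (C₂ • (D • W').quadraticTwist ((-1 : ℚ) ^ (3 / 2) * (3 : ℕ))).analyticRank = 1)
    {V : WeierstrassCurve ℚ} [V.IsElliptic] [V.IsGloballyMinimal] (CV : VariableChange ℚ) (hV : GoodOrd V 3)
    (ha : (3 : ℤ) ∣ V.frobeniusTrace 3 - 1)
    (hCV : CV • V.quadraticTwist ((-1 : ℚ) ^ (3 / 2) * (3 : ℕ)) = C₂ • (D • W').quadraticTwist ((-1 : ℚ) ^ (3 / 2) * (3 : ℕ)))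
    (hnorm : ∀ Φ : AddSubgroup (geomTorsion (C₂ • (D • W').quadraticTwist ((-1 : ℚ) ^ (3 / 2) * (3 : ℕ))) ((3 : ℕ) : ℤ)),
      IsRationalLine (C₂ • (D • W').quadraticTwist ((-1 : ℚ) ^ (3 / 2) * (3 : ℕ))) 3 Φ →
        ¬ LineDecompositionTrivialAt (C₂ • (D • W').quadraticTwist ((-1 : ℚ) ^ (3 / 2) * (3 : ℕ))) 3 Φ)
    -- the ♭-frame at the conjugate prime
    {ΩK' : ℂ} {Ωp' : ℂ_[3]} {Q : PowerSeries (PadicComplexInt 3)} (hΩK' : ΩK' ≠ 0) (hΩp' : Ωp' ≠ 0)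
    (hQ : R1.IsBDPLFunctionInt 3 ι' 𝔭' κ γ Dt.f ΩK' Ωp' Q) :
    (XAc.charIdeal ((C₂ • (D • W').quadraticTwist ((-1 : ℚ) ^ (3 / 2) * (3 : ℕ))).baseChange K) 3 κ 𝔭 ∅ γ).map
        (PowerSeries.map (R1.toCpInt 3)) ≤ Ideal.span {Q} := by
  have hp2 : (3 : ℕ) ≠ 2 := by norm_num
  have hsplit : ((Ideal.span {((3 : ℕ) : ℤ)}).primesOver (𝓞 K)).ncard = 2 :=
    ncard_primesOver_eq_two_of_degreeOne hK.1 h𝔭 he hf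
  obtain ⟨he', hf'⟩ := degreeOne_of_splitsIn hK.1 hsplit h𝔭'
  have hne' : 𝔭' ≠ 𝔭 := fun h ↦ hne h.symm
  have hHe3 : SatisfiesHeegnerHypothesis 3 K := by
    intro ℓ hℓ hℓ3
    obtain rfl : ℓ = 3 := (Nat.prime_dvd_prime_iff_eq hℓ (Fact.out : Nat.Prime 3)).mp hℓ3
    exact hsplit
  -- the conductor exponent of `χ_ε` above the split prime `3` is `1` (Literature theorem)
  have hcond : ∀ 𝔮 : HeightOneSpectrum (𝓞 K), ((3 : ℕ) : 𝓞 K) ∈ 𝔮.asIdeal →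
      (KellerYin2024.genusHeckeCharacter K 3).HasConductorExponentAt 𝔮 1 := fun 𝔮 h𝔮 ↦
    KellerYin2024.genusHeckeCharacter_hasConductorExponentAt_one_of_split K 3 hp2 hK hsplit h𝔮
  -- step 1: the SIGNED branch frame of `(Dt′.f, χ_ε)` at `𝔭′` (Castella–Hsieh, published)
  obtain ⟨e, ΩK, Ωp, L, hesign, hΩK, hL⟩ := hCHσ ι' W' K 𝔭' κ γ Dt'.isNewformOf (KellerYin2024.genusHeckeCharacter K 3) hp2
    hpN' hK hodd hdK hsplit h𝔭' hι' hHe' hκ hγ.out (KellerYin2024.genusHeckeCharacter_sq K 3)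
    (fun w hw ↦ KellerYin2024.genusHeckeCharacter_isUnramifiedAt K 3 hw) hcond
  have hΩp : ((Ωp : unrIntegers 3) : ℂ_[3]) ≠ 0 := by
    rw [Ne, ZeroMemClass.coe_eq_zero]
    exact Ωp.ne_zero
  -- step 2: Keller–Yin's standing data for the curve itself at `(v, v̄) = (𝔭′, 𝔭)`: `hlat` and `W(K)[3] = 0` from the normalisation
  obtain ⟨Φ₀, hΦ₀⟩ := exists_isRationalLine_of_not_irr _ 3 hX.1
  have htf := AnomalousTwistOrientation.forall_baseChange_nsmul_eq_zero_of_anomalousTwist_of_normalised (p := 3) (K := K) rfl hV ha CV hCV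
    hnorm hX.1 hK h𝔭' h𝔭 hne
  have hS := potOrdSetting_of_socketData hp2 ι' _ K 𝔭 𝔭' κ N hN hcase hX.1 ⟨Φ₀, hΦ₀, hnorm Φ₀ hΦ₀⟩ htf hK hHe hodd hdK hκ h𝔭 he hf
    hne hι'
  have htw : ∃ S : Finset ℕ, ∀ ℓ : ℕ, ℓ.Prime → ℓ ∉ S →
      cuspCoeff Dt.f ℓ = ((legendreSym 3 ℓ : ℤ) : ℂ) * cuspCoeff Dt'.f ℓ :=
    exists_cofinite_cuspCoeff_eq_legendreSym_mul hp2 W' D C₂ Dt Dt'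
  -- step 2b: the embedding at `𝔭′`, the restricted Teichmüller pair, the `3`-unramified member `θquot`, its Hecke character and Katz frame
  have hιv : ∀ x : 𝓞 K, x ∈ 𝔭'.asIdeal ↔ ‖embAt K 3 𝔭' h𝔭' he' hf' (x : K)‖ < 1 :=
    fun x ↦ mem_asIdeal_iff_norm_embAt_lt_one 𝔭' h𝔭' he' hf' x
  obtain ⟨Ψ, hΨ, θsub, θquot, hsub, hquot⟩ := exists_teichmullerPair _ 3 hX.1
  have hpair := isResidualPairOver_restrictField _ 3 K hΨ hsub hquot
  have hθp : ∀ u : HeightOneSpectrum (𝓞 ℚ), ((3 : ℕ) : 𝓞 ℚ) ∈ u.asIdeal → θquot.IsUnramifiedAt u :=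
    KYBranchThreeAnomalous.isUnramifiedAt_three_quotChar_of_anomalousTwist_of_normalised hV ha CV hCV hnorm hK h𝔭' h𝔭 hne hΨ hsub hquot
  have hθC : ∀ u : HeightOneSpectrum (𝓞 ℚ), ((N : ℤ) : 𝓞 ℚ) ∉ u.asIdeal → θquot.IsUnramifiedAt u := by
    intro u hu
    exact KYBranchThreeAnomalous.isUnramifiedAt_quotChar_of_conductorNorm_notMem hX.2 hΨ hquot u (by rw [hN]; exact hu)
  have hTK : ∀ σ : absoluteGaloisGroup K, (θquot.restrictField K) σ ^ (3 - 1) = 1 := fun σ ↦ by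
    rw [FramedGaloisRep.restrictField_apply]; exact hquot.1 _
  obtain ⟨θK, -, hθK⟩ := exists_heckeCharacter_of_pow_eq_one (∅ : Set (PadicAlgCl 3)) ι' (θquot.restrictField K) hTK
  have hθK' : IsHeckeCharOf ι' (θquot.restrictField K) θK := hθK
  have hunrK : ∀ w : HeightOneSpectrum (𝓞 K), ((3 : ℕ) : 𝓞 K) ∈ w.asIdeal → (θquot.restrictField K).IsUnramifiedAt w := by
    intro w hw
    have h3u : ((3 : ℕ) : 𝓞 ℚ) ∈ (w.under (𝓞 ℚ)).asIdeal := by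
      rw [HeightOneSpectrum.under_asIdeal, Ideal.under_def, Ideal.mem_comap, map_natCast]
      exact hw
    exact FramedGaloisRep.isUnramifiedAt_restrictField θquot (w := w) (v := w.under (𝓞 ℚ)) rfl (hθp _ h3u)
  obtain ⟨ΩK₀, Ωp₀, Lφ, hΩK₀, hLφ⟩ := h212 3 (by norm_num) K hK hHe3 hodd hdK (embAt K 3 𝔭' h𝔭' he' hf') 𝔭' 𝔭 hιv h𝔭 hne
    κ hκ γ ι' hι' θquot hquot.1 N hHe hθC hθp θK hθK'
  have hCbar : ∀ u ∈ (∅ : Finset (HeightOneSpectrum (𝓞 K))), ¬ θK.IsUnramifiedAt u := fun u hu ↦ absurd hu (Finset.notMem_empty u)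
  -- CGLS's set `S`, keyed to `N` and to `N_W`
  obtain ⟨Sf, hSf⟩ := KYBranchThree.exists_finset_primes_over_not_three (K := K) N
  have hSf' : ∀ w : HeightOneSpectrum (𝓞 K), w ∈ Sf ↔
      (((((C₂ • (D • W').quadraticTwist ((-1 : ℚ) ^ (3 / 2) * (3 : ℕ)))).conductorNorm ℤ : ℤ) : 𝓞 K) ∈ w.asIdeal ∧ ((3 : ℕ) : 𝓞 K) ∉ w.asIdeal) := by
    rw [hN]; exact hSf
  -- step 3: the analytic COUNT by name at `θ₀ := θquot|_K`, then FILE 13 (Keller–Yin Thm. 3.5.1, branch currency, anomalous)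
  obtain ⟨n, nφ, hLn, hLφn, hcount⟩ := hAN ι' _ K 𝔭' 𝔭 κ γ Dt.isNewformOf hS Dt'.isNewformOf.1 hpN' htw (θsub.restrictField K)
    (θquot.restrictField K) hpair Sf hSf (θquot.restrictField K) (Or.inr rfl) θK hθK' (hθK 𝔭' (hunrK 𝔭' h𝔭')).1
    (hθK 𝔭 (hunrK 𝔭 h𝔭)).1 ∅ hCbar ΩK₀ Ωp₀ Lφ hΩK₀ hLφ e ΩK Ωp L hesign hΩK hL
  have hCD2 : groupCdLE_two_galoisGroupUnramifiedOutside K := groupCdLE_two_galoisGroupUnramifiedOutside_holds K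
  have heq := (KYBranchThreeAnomalous.xac_charIdeal_map_eq_span_three_anomalous_of_dvd h263 h41 h42 h5A h32 hRH hPWL h331 h411 hF hO1
    hDVD ι' _ K 𝔭' 𝔭 κ γ Dt.isNewformOf hS hr hX hSG hV ha CV hCV hnorm hCD2 (embAt K 3 𝔭' h𝔭' he' hf') hιv Dt'.isNewformOf.1 hpN' htw
    hΨ hsub hquot hθK' hCbar hΩK₀ hLφ hesign hΩK hL Sf hSf' hLn hLφn hcount (toUnr 3) (coe_toUnr 3)).1
  have hdiv : (XAc.charIdeal ((C₂ • (D • W').quadraticTwist ((-1 : ℚ) ^ (3 / 2) * (3 : ℕ))).baseChange K) 3 κ 𝔭 ∅ γ).map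
      (PowerSeries.map (toUnr 3)) ≤ Ideal.span {L} := by
    rw [xac_charIdeal_eq_literature, heq]
  -- step 4: rigidity — `(L) ⊆ (Q)` since the constant `ι′⁻¹(±1)` is integral
  have hKp : Algebra.IsUnramifiedIn (𝓞 K) (Ideal.span {((3 : ℕ) : ℤ)}) := isUnramifiedIn_of_splitsTwo hK hsplit
  obtain ⟨c, hc, -⟩ := exists_coe_eq_symm_of_sign (p := 3) (ι := ι') hesign
  have hLQ : Ideal.span {PowerSeries.map (R1.unrToCpInt 3) L} ≤ Ideal.span {Q} :=
    span_map_le_span_of_isBranchBDPLFunction_of_isBDPLFunctionInt hp2 hK hKp Dt.f Dt'.f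
      (fun _ hℓ hℓp ↦ cuspCoeff_eq_legendreSym_mul_of_presentation hp2 W' D C₂ Dt.isNewformOf Dt'.isNewformOf hℓ hℓp)
      (cuspCoeff_prime_eq_zero_of_presentation hp2 W' hgood D C₂ Dt)
      (prime_dvd_level_of_presentation hmodN hp2 W' hgood D C₂ Dt)
      (fun _ hℓ hℓp ↦ dvd_level_iff_dvd_level_partner_of_presentation hmodN hp2 W' hgood D C₂ Dt Dt' hℓ hℓp)
      hκ hγ.out hΩK hΩK' hΩp hΩp' hL hQ hc
  exact (map_toCpInt_le_span_of_map_toUnr_le_span hdiv).trans hLQ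

/-! ### §2 The per-datum (G-ord, `e = 2`) lower socket at `p = 3` off the sliver, ANOMALOUS twist, Keller–Yin-normalised curve, NO existence hypothesis -/

/-- **The (G-ord, `e = 2`) LOWER socket AT `p = 3`, OFF the `d_K = −3` sliver, for a Keller–Yin-normalised curve with an ANOMALOUS twist model ⇐
Kolyvagin ∧ modularity ∧ Hsieh 2014 Thm. A ∧ Liu–Zhang–Zhang 2018 ∧ Castella–Hsieh signed ∧ [DIV.dvd] ∧ the typed hna-free count ∧ CGLS Thm. 2.1.2
∧ [RH] ∧ [PWL-θ] ∧ the published facts** — the anomalous twin of generation 26/27's `additiveIMCLowerBDPOnTree_subGordTwo_three_offSliver_self`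
/ `_of_thm212`: for EVERY globally minimal `W` of the cell with `r_an = 1`, an anomalous good-ordinary twist model `W = C • V^{(3*)}`
(`3 ∣ a₃(V) − 1`) and the ∀-normalisation, at every Heegner datum of `(W, 3)` with `d_K ≠ −3` and every anticyclotomic frame `(κ, γ, 𝔭)`:
`AdditiveIMCLowerBDPOnTreeLeAt 3 κ 𝔭 γ ι_𝔭 (v_3 c) P`.  (§1 at the conjugate prime inside generation 21's
`additiveIMCLowerBDPOnTreeLeAt_of_kolyvagin_of_hsieh_of_lzz_of_intDivConj`; `W(K)[3] = 0` is no longer a hypothesis.)  CONDITIONAL on the displayed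
named statements; nothing asserted about BSD. [claim: KellerYin2024PotOrd, status: under-review]
[cite: KellerYin2024b, Thm. 3.3.6, Prop. 3.4.4, Thm. 3.5.1, Rem. 3.5.2, Assumption 2.0.3 (arXiv:2410.23241 pp. 8, 19–20) (preprint; the Kolyvagin clause a hypothesis)]
[cite: CastellaHsieh2018, §3.3, Def. 3.7 and Prop. 3.8] [cite: Hsieh2014, Thm. A p. 712 (Doc. Math. 19)]
[cite: LiuZhangZhang2018, Thm 1.5.1 and Thm 1.5.3 (Duke Math. J. 167 pp. 748–749)] [cite: CastellaGrossiLeeSkinner2022, Thms. 2.1.2, 2.2.2] -/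
theorem additiveIMCLowerBDPOnTree_subGordTwo_three_offSliver_anomalous_self
    (hKo : ∀ (N : ℕ) [NeZero N] (W : WeierstrassCurve ℚ) (K : Type) [Field K] [NumberField K],
      Literature.NumberTheory.EllipticCurves.kolyvagin N W K)
    (hPar : nonempty_modularParametrizationData)
    (hA : Hsieh2014.thmA_exists_isHsiehLFunction_unrPeriod_anyLevel)
    (hL : LiuZhangZhang2018.thm151_thm153_modularCurve_heegnerVector_additive)
    (hCHσ : castellaHsieh2018_exists_isBranchBDPLFunction_signed)
    (hDVD : thm336_dvd_branch_OPEN) (hAN : thm351_anacong_branch_three_allTwists) (h212 : thm212_exists_isKatzLFunction)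
    (hRH : thm122_rubinHida_residualPair_unrSelmer) (hPWL : prop125_residualPair_unrSelmer_imprimitive)
    (h331 : thm331_rubin_exists_katzMeasure₂_pseudoIso_span_eq) (h411 : prop411_selmer_isAlmostDivisible)
    (hF : thmII64_katzMeasure₂_functionalEquation) (hO1 : thmI_mu_katzBranch_reflect_eq_zero)
    (h263 : prop263_sur_of_crk) (h41 : prop41_globalEulerPoincareCorank)
    (h42 : prop42_localEulerPoincareCorank) (h5A : sec5A_localH2_subsingleton_of_LOC1)
    (h32 : prop32_cohomology_isCofinitelyGenerated) :
    ∀ (W : WeierstrassCurve ℚ) [W.IsElliptic] [W.IsGloballyMinimal],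
      W.analyticRank = 1 → ClassX3 W 3 → SubGordTwo W 3 →
      ∀ (V : WeierstrassCurve ℚ) [V.IsElliptic] [V.IsGloballyMinimal] (CV : VariableChange ℚ),
        GoodOrd V 3 → (3 : ℤ) ∣ V.frobeniusTrace 3 - 1 → CV • V.quadraticTwist ((-1 : ℚ) ^ (3 / 2) * (3 : ℕ)) = W →
      (∀ Φ : AddSubgroup (geomTorsion W ((3 : ℕ) : ℤ)), IsRationalLine W 3 Φ → ¬ LineDecompositionTrivialAt W 3 Φ) →
      ∀ (N : ℕ) [NeZero N] (K : Type) [Field K] [NumberField K]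
        (Dt : ModularParametrizationData W N) (H : HeegnerDatum N (NumberField.discr K)) (ι : K →+* ℂ)
        (P : (W.baseChange K).toAffine.Point),
        W.analyticRank = 1 → Additive.N10.Locus W 3 → W.conductorNorm ℤ = N → IsImaginaryQuadratic K →
        Odd (NumberField.discr K) → ¬ 3 ∣ Units.torsionOrder K → SatisfiesHeegnerHypothesis N K →
        (W.quadraticTwist (NumberField.discr K : ℚ)).entireLFunction 1 ≠ 0 →
        WeierstrassCurve.Affine.Point.map ι.toRatAlgHom P = heegnerPointComplex Dt H →
        ¬ IsOfFinAddOrder P → NumberField.discr K ≠ -3 →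
        ∀ (κ : ZpExtension K 3), κ.IsAnticyclotomic →
          ∀ (γ : Field.absoluteGaloisGroup K) [Fact (κ.IsTopGenerator γ)]
            (𝔭 : HeightOneSpectrum (𝓞 K)) (h𝔭 : ((3 : ℕ) : 𝓞 K) ∈ 𝔭.asIdeal)
            (he : 𝔭.asIdeal.ramificationIdx (𝓞 ℚ) = 1) (hf : 𝔭.asIdeal.inertiaDeg (𝓞 ℚ) = 1),
            AdditiveIMCLowerBDPOnTreeLeAt 3 κ 𝔭 γ (embAt K 3 𝔭 h𝔭 he hf) (padicValNat 3 Dt.c.natAbs) P := by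
  intro W _ _ hr hX hS V _ _ CV hV ha hCV hnorm
  have hp2 : (3 : ℕ) ≠ 2 := by norm_num
  -- present the door's curve through its good-ordinary partner
  obtain ⟨W', hE', hmin', C₂, hW, hord, hΔ⟩ :=
    exists_goodOrd_partner_presentation_of_subGordTwo_odd hp2 W hX hS
  subst hW
  haveI : NeZero (W'.conductorNorm ℤ) := ⟨(WeierstrassCurve.conductorNorm_pos_holds W').ne'⟩
  intro N _ K _ _ Dt H ι P hr' hloc hN hK hodd hunit hHe hL1 hP hnt hdK κ hκ γ _ 𝔭 h𝔭 he hf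
  refine additiveIMCLowerBDPOnTreeLeAt_of_kolyvagin_of_hsieh_of_lzz_of_intDivConj hKo hA hL hp2 hX (Or.inr hS) Dt H ι P
    hr' hloc hN hK hodd hunit hHe hL1 hP hnt κ hκ γ 𝔭 h𝔭 he hf ?_
  intro 𝔮 h𝔮 hne he' hf' ι' hι' ΩK Ωp Q hΩK hΩp hQ
  -- a parametrisation datum of the partner; `K/ℚ` is Galois
  obtain ⟨Dt'⟩ := hPar W'
  haveI : IsGalois ℚ K := Literature.FieldTheory.Galois.isGalois_of_finrank_eq_two hK.1
  -- the partner's level is prime to `3` and inherits the Heegner hypothesis (`N_{W′} ∣ N`)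
  have hpN' : ¬ 3 ∣ W'.conductorNorm ℤ := not_dvd_conductorNorm_of_hasGoodReductionAtPrime W' hord.1
  have hmodN : exists_isNewformOf := exists_isNewformOf_of_nonempty_modularParametrizationData hPar
  have hHe' : SatisfiesHeegnerHypothesis (W'.conductorNorm ℤ) K :=
    SatisfiesHeegnerHypothesis.of_dvd (conductorNorm_partner_dvd_level hmodN hp2 W' hord.1 _ C₂ Dt) hHe
  -- Case (I) for the curve itself, from the cell
  have hcase := hasGoodOrdinaryReductionOverQuadraticAt_of_subGordTwo hp2 _ hX hS
  exact xac_charIdeal_map_le_span_three_self_anomalous_of_dvd hCHσ hDVD hAN h212 hRH hPWL h331 h411 hF hO1 h263 h41 h42 h5A h32 hmodN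
    W' hord.1 _ C₂ Dt Dt' hpN' hK hHe hHe' hodd hdK hκ γ h𝔭 he hf h𝔮 hne hι' hN hcase hX hS hr CV hV ha hCV hnorm hΩK hΩp hQ

end Summit.BirchSwinnertonDyer.BirchSwinnertonDyer.Theorems.SchneiderFreeAdditiveX3.KYBranchThreeAnomalousDoor

end
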